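import Summits.ResolutionOfSingularities.ResolutionOfSingularities.Theorems.RegularCurveDepthRel
import HarnessLib

/-!
# RegularCurveFrame — tree file 3/6: §10 (NEW · KERNEL) one blowing up: regular CURVE FRAMES and the exact depth
drop (`CurveFrame`,
`DepthDrop` / `DepthKeep`, `curveFrame_point`, `curveFrame_foreign`) — scheme level, universe-generic, tree
imports only.  PROVED.

Content VERBATIM from the decomp-res lens-6 g17 file
`HOME/decomp-res-lens-6/g17/parts/RegularCurveLaw-REV1-5548be76.lean` (sha256 5548be7624d15d37;
CRITIC-LEDGER row 128; critic landing order 2026-08-30T18:16:59Z).  Its §0–§8 are g16 `AbsoluteGiraud.lean`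
@bc25b587 byte-identical and ALREADY in
the tree as `Theorems/AbsoluteContact{Scope,Primitives,HasseRing,Hasse,Axes}` + `AbsoluteGiraud{Kernel,Branch}`;
only §9–§13 are landed here — §11–§13 in the text of the lens's rev 2 TREE-SYNC pin
`parts/RegularCurveLaw-REV2-fe4ab852.lean`
(code byte-identical to rev 1; five docstrings sharpened for the critic's hygiene asks h1/h2/h4, STATUS 18:31:35Z).
HOME = run/shared/lean/pub/decomp-res.  Host: route `MaxContactCut`, asides AGHypHug3Insep 27753 / AGAbsContactOff3
27752 / AGAllHug3Off3 27751
(refining 31574 `PVPureGame`).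

[WRITER NOTE (decomp-res writer g6): the critic asked for Literature/…/Resolution placement of the scheme-level
kernels §9/§10; they land
Summits-side because the Literature gate accepts only [cite:]-tagged PUBLISHED statements (same ruling as `CouplingCutCoupled` /
`AbsoluteGiraudKernel`).  ONE namespace `…Theorems.AbsoluteContactClasses` as in the lens; global `set_option`
lines dropped (scoped
`set_option maxHeartbeats … in` kept); nothing else changed.]
(Sources: Giraud1975; EncinasVillamayor2000 Thm. 4.9; BravoGarciaEscamillaVillamayor2012 Lemma 4.6;
VillamayorU2008ReesDiff §4; CossartPiltant2008 §2; CossartJannsenSaito2020 §2–§3; EGAIV4 §16–§17;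
Matsumura1986 §14–§17.)
-/

noncomputable section

open CategoryTheory AlgebraicGeometry TopologicalSpace
open Literature.AlgebraicGeometry.Resolution
open Summit.ResolutionOfSingularities.ResolutionOfSingularities.Theorems
open WeakOrderReduction ForcedTowerClasses PurityValveClasses
open SatelliteExitClasses
open IsLocalRing MvPolynomial

namespace Summit.ResolutionOfSingularities.ResolutionOfSingularities.Theorems.AbsoluteContactClasses

/-! ## §10 (g17 · NEW · KERNEL) One blowing up: regular curve frames and the exact depth drop -/

section CurveFrameKernel

universe uG

/-- An rsop-part of length `n` in a local ring of dimension `≤ n` is a full regular system of parameters. [folklore] -/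
theorem span_eq_maximalIdeal_of_dim_le {R : Type*} [CommRing R] [IsLocalRing R] {n : ℕ}
    {z : Fin n → R} (hz : IsRsopPart z) (h : ringKrullDim R ≤ n) :
    Ideal.span (Set.range z) = maximalIdeal R := by
  obtain ⟨hR, e, y, hdim, hspan⟩ := hz
  have he : e = 0 := by
    rw [hdim] at h
    have : n + e ≤ n := by exact_mod_cast h
    omega
  subst he
  rwa [Set.range_eq_empty y, Set.union_empty] at hspan

/-- Cancellation in `WithBot ℕ∞`: `x + r = n + r ⟹ x = n`. [folklore] -/
theorem eq_of_add_natCast_eq {x : WithBot ℕ∞} {r n : ℕ}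
    (h : x + (r : WithBot ℕ∞) = ((n + r : ℕ) : WithBot ℕ∞)) : x = n := by
  induction x using WithBot.recBotCoe with
  | bot =>
    exfalso
    rw [WithBot.bot_add] at h
    exact WithBot.bot_ne_natCast _ h
  | coe a =>
    induction a using ENat.recTopCoe with
    | top =>
      exfalso
      have h' : ((⊤ : ℕ∞) : WithBot ℕ∞) + (r : WithBot ℕ∞) = ((⊤ : ℕ∞) : WithBot ℕ∞) := by
        rw [← WithBot.coe_natCast, ← WithBot.coe_add, top_add]
      rw [h'] at h
      exact ENat.top_ne_coe _ (WithBot.coe_inj.mp (h.trans (WithBot.coe_natCast _).symm))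
    | coe a =>
      have h2 : a + r = n + r := by exact_mod_cast h
      have : a = n := by omega
      subst this
      exact (WithBot.coe_natCast a)

/-- **Transversal parameter.** An rsop-part `w` of length `r` in a local ring of dimension `r + 1` extends by ONE
element `s` to a regular system of parameters `(s, w)`. (Sources: Matsumura1987, Thm. 14.2.) -/
theorem exists_transversal {R : Type*} [CommRing R] [IsLocalRing R] {r : ℕ} {w : Fin r → R}
    (hw : IsRsopPart w) (hdim : ringKrullDim R = ((r + 1 : ℕ) : WithBot ℕ∞)) :
    ∃ s : R, IsRsopPart (Fin.cons s w : Fin (r + 1) → R) ∧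
      Ideal.span (Set.range (Fin.cons s w : Fin (r + 1) → R)) = maximalIdeal R := by
  haveI := hw.isRegularLocalRing
  obtain ⟨e, c, hd, hc, hc0⟩ := hw.exists_rsop
  have he : e = 1 := by
    have h := IsRegularLocalRing.spanFinrank_maximalIdeal (R := R)
    rw [hdim, hd] at h
    have : r + e = r + 1 := by exact_mod_cast h
    omega
  subst he
  let ι : Fin (r + 1) → Fin (r + 1) := Fin.cons (Fin.last r) Fin.castSucc
  have hι : Function.Injective ι := by
    intro a b hab
    induction a using Fin.cases with
    | zero =>
      induction b using Fin.cases with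
      | zero => rfl
      | succ b =>
        exfalso
        simp only [ι, Fin.cons_zero, Fin.cons_succ] at hab
        exact (Fin.castSucc_lt_last b).ne hab.symm
    | succ a =>
      induction b using Fin.cases with
      | zero =>
        exfalso
        simp only [ι, Fin.cons_zero, Fin.cons_succ] at hab
        exact (Fin.castSucc_lt_last a).ne hab
      | succ b =>
        simp only [ι, Fin.cons_succ] at hab
        rw [Fin.castSucc_inj.mp hab]
  have hcι : c ∘ ι = (Fin.cons (c (Fin.last r)) w : Fin (r + 1) → R) := by
    funext m
    induction m using Fin.cases with
    | zero => simp [ι]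
    | succ j =>
      simp only [Function.comp_apply, ι, Fin.cons_succ]
      exact hc0 j
  refine ⟨c (Fin.last r), ?_, ?_⟩
  · rw [← hcι]; exact isRsopPart_comp_of_rsop hd c hc ι hι
  · rw [← hcι, (Finite.surjective_of_injective hι).range_comp]
    exact hc

/-- Saturating `(t) · N` by the powers of `(t)` gives back the prime `N ∌ t` (`t` a non-zero-divisor). [folklore] -/
theorem iSup_colon_span_singleton_mul_eq {S : Type*} [CommRing S] {t : S} (ht : t ∈ nonZeroDivisors S)
    {N : Ideal S} (hN : N.IsPrime) (htN : t ∉ N) :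
    (⨆ m : ℕ, Submodule.colon (Ideal.span {t} * N) ((Ideal.span {t} ^ m : Ideal S) : Set S)) = N := by
  apply le_antisymm
  · refine iSup_le fun m => fun a ha => ?_
    have h1 : a * t ^ m ∈ Ideal.span {t} * N :=
      Submodule.mem_colon.mp ha (t ^ m) (Ideal.pow_mem_pow (Ideal.mem_span_singleton_self t) m)
    obtain ⟨z, hz, hza⟩ := Ideal.mem_span_singleton_mul.mp h1
    rcases m with _ | m
    · rw [pow_zero, mul_one] at hza
      rw [← hza]
      exact N.mul_mem_left t hz
    · have h2 : a * t ^ m ∈ N := by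
        have h3 : t * (a * t ^ m) = t * z := by rw [hza]; ring
        rw [(mul_cancel_left_mem_nonZeroDivisors ht).mp h3]
        exact hz
      rcases hN.mem_or_mem h2 with h4 | h4
      · exact h4
      · exact absurd (hN.mem_of_pow_mem m h4) htN
  · refine le_iSup_of_le 1 fun a ha => ?_
    refine Submodule.mem_colon.mpr fun s hs => ?_
    rw [pow_one] at hs
    obtain ⟨b, rfl⟩ := Ideal.mem_span_singleton'.mp hs
    rw [smul_eq_mul, show a * (b * t) = t * (a * b) by ring]
    exact Ideal.mul_mem_mul (Ideal.mem_span_singleton_self t) (N.mul_mem_right b ha)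

/-- **Regular curve frame** at `y` for the ideal sheaf `H`: `H_y = (w_1, …, w_r)` with `w` part of a regular system of
parameters of `𝒪_y` and `dim 𝒪_y = r + 1` — `V(H)` is a REGULAR CURVE GERM at `y`. DEFINITION (support). -/
def CurveFrame {Y : Scheme.{uG}} (H : Y.IdealSheafData) (r : ℕ) (y : Y) : Prop :=
  ∃ w : Fin r → Y.presheaf.stalk y, IsRsopPart w ∧ stalkIdeal H y = Ideal.span (Set.range w) ∧
    ringKrullDim (Y.presheaf.stalk y) = ((r + 1 : ℕ) : WithBot ℕ∞)

/-- **Exact-depth DROP law** between two filtered pairs `(I, P)` and `(I', P')` with exponent `b`: an element of `I`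
of exact `P`-depth `(c, ν)` (`c < b`, `ν ≥ b - c`) yields an element of `I'` of exact depth `(c, ν − (b − c))`.
DEFINITION (support). -/
def DepthDrop {R S : Type*} [CommRing R] [CommRing S] [IsLocalRing R] [IsLocalRing S]
    (I P : Ideal R) (I' P' : Ideal S) (b : ℕ) : Prop :=
  ∀ (c ν : ℕ) (f : R), c < b → b - c ≤ ν → f ∈ I → f ∈ depthIdeal P c ν → f ∉ depthIdeal P c (ν + 1) →
    ∃ f' ∈ I', f' ∈ depthIdeal P' c (ν - (b - c)) ∧ f' ∉ depthIdeal P' c (ν - (b - c) + 1)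

/-- **Exact-depth KEEP law** (foreign rounds: a local isomorphism). DEFINITION (support). -/
def DepthKeep {R S : Type*} [CommRing R] [CommRing S] [IsLocalRing R] [IsLocalRing S]
    (I P : Ideal R) (I' P' : Ideal S) : Prop :=
  ∀ (c ν : ℕ) (f : R), f ∈ I → f ∈ depthIdeal P c ν → f ∉ depthIdeal P c (ν + 1) →
    ∃ f' ∈ I', f' ∈ depthIdeal P' c ν ∧ f' ∉ depthIdeal P' c (ν + 1)

variable {X X' : Scheme.{uG}} {π : X' ⟶ X} {C : X.IdealSheafData}

set_option maxHeartbeats 800000 in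
/-- **POINT ROUND (regular curve frame).** Blow up the closed point `x = π y` (`C_x = 𝔪_x`); let `V(H) ∋ x` be a
regular curve germ (`CurveFrame H r x`) whose strict transform passes through `y`. Then: the chart at `y` is the
TRANSVERSAL one, `(t, w/t)` is a regular system of parameters of `𝒪_y` (`t` the exceptional parameter), `dim 𝒪_y =
dim 𝒪_x`, the strict transform of `H` has stalk `(w/t)` at `y` — a regular curve frame again — and for any `I` with
`I_x ⊆ 𝔪_x^b` the controlled transform `I' = (π^{-1} I : E^b)` obeys the exact-depth DROP law. (Sources:
StacksProject, Tag 0BIQ; Matsumura1987, Thm. 14.2, Thm. 15.5; DeJong1996, 2.4.) -/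
theorem curveFrame_point (hπ : IsBlowup π C) [IsLocallyNoetherian X] [IsLocallyNoetherian X'] (y : X')
    (hC : stalkIdeal C (π y) = maximalIdeal (X.presheaf.stalk (π y)))
    (H : X.IdealSheafData) (r : ℕ) (hy : y ∈ ((strictTransformIdeal π C H).support : Set X'))
    (h : CurveFrame H r (π y)) (I : X.IdealSheafData) (b : ℕ)
    (hIb : stalkIdeal I (π y) ≤ maximalIdeal _ ^ b) :
    CurveFrame (strictTransformIdeal π C H) r y ∧
      DepthDrop (stalkIdeal I (π y)) (stalkIdeal H (π y))
        (stalkIdeal (controlledTransform π C I b) y) (stalkIdeal (strictTransformIdeal π C H) y) b := by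
  classical
  obtain ⟨w, hw, hHw, hdim⟩ := h
  haveI : IsRegularLocalRing (X.presheaf.stalk (π y)) := hw.isRegularLocalRing
  obtain ⟨s, hsw, hfull⟩ := exists_transversal hw hdim
  set γ : Fin (r + 1) → X.presheaf.stalk (π y) := Fin.cons s w with hγdef
  have hγ0 : γ 0 = s := by simp [hγdef]
  have hγs : ∀ j : Fin r, γ j.succ = w j := fun j => by simp [hγdef]
  have hcC : Ideal.span (Set.range γ) = stalkIdeal C (π y) := hfull.trans hC.symm
  set T : Set (Fin (r + 1)) := Set.range (Fin.succ : Fin r → Fin (r + 1)) with hTdef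
  have hγT : γ '' T = Set.range w := by
    rw [hTdef, ← Set.range_comp]
    exact congrArg Set.range (funext hγs)
  have hTH : Ideal.span (γ '' T) = stalkIdeal H (π y) := by rw [hγT, hHw]
  obtain ⟨i, 𝔴, χ, hχ, hloc, h𝔴⟩ := hπ.exists_reesChart_stalk y γ hcC
  obtain ⟨hE, hH'⟩ := hπ.stalkIdeal_controlledTransform_eq_span_chartGen y γ hcC T hTH i 𝔴 χ hχ hloc
  letI alg : Algebra (chartRing γ i) (X'.presheaf.stalk y) := χ.toAlgebra
  haveI : IsLocalization.AtPrime (X'.presheaf.stalk y) 𝔴.asIdeal := hloc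
  haveI : 𝔴.asIdeal.IsPrime := 𝔴.isPrime
  have halg : ∀ a, algebraMap (chartRing γ i) (X'.presheaf.stalk y) a = χ a := fun a => by
    rw [RingHom.algebraMap_toAlgebra]
  set σ := (π.stalkMap y).hom with hσdef
  -- the chart generators `e_j`, `j ∈ T`, vanish at `y` because `y` lies on the strict transform of `V(H)`
  have hweak_le : stalkIdeal (controlledTransform π C H 1) y ≤ maximalIdeal _ :=
    (stalkIdeal_mono (controlledTransform_le_strictTransformIdeal π C H 1) y).trans
      ((mem_support_iff_stalkIdeal_le _ _).mp hy)
  have hz'm : ∀ j : Fin r, χ (chartGen γ i j.succ) ∈ maximalIdeal (X'.presheaf.stalk y) := fun j => by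
    apply hweak_le
    rw [hH']
    exact Ideal.subset_span ⟨j.succ, ⟨j, rfl⟩, rfl⟩
  have hmem𝔴 : ∀ j : Fin r, chartGen γ i j.succ ∈ 𝔴.asIdeal := fun j => by
    have h2 := hz'm j
    rw [← halg] at h2
    exact (IsLocalization.AtPrime.to_map_mem_maximal_iff (X'.presheaf.stalk y) 𝔴.asIdeal _).mp h2
  -- hence the chart is the transversal one: `i = 0`
  have hi0 : i = 0 := by
    rcases Fin.eq_zero_or_eq_succ i with h0 | ⟨j, hj⟩
    · exact h0
    · exfalso
      have h1 := hmem𝔴 j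
      have h2 : chartGen γ i i = 1 := chartGen_self γ i
      rw [← hj, h2] at h1
      exact 𝔴.isPrime.ne_top ((Ideal.eq_top_iff_one _).mpr h1)
  subst hi0
  -- the exceptional parameter `t = π^* s`
  set t : X'.presheaf.stalk y := χ (chartBase γ 0 (γ 0)) with htdef
  have hσs : σ s = t := by rw [← hγ0]; exact (hχ (γ 0)).symm
  have hnzd : t ∈ nonZeroDivisors (X'.presheaf.stalk y) := by
    rw [htdef, ← halg]
    exact IsLocalization.nonZeroDivisors_le_comap 𝔴.asIdeal.primeCompl _ (reesChartBase_mem_nonZeroDivisors _ _)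
  -- the transformed frame `w'_j = e_{j+1}` with `π^* w_j = t · w'_j`
  let w' : Fin r → X'.presheaf.stalk y := fun j => χ (chartGen γ 0 j.succ)
  have hww' : ∀ j, σ (w j) = t * w' j := fun j => by
    rw [← hγs, ← hχ, htdef, ← map_mul, ← reesChartBase_apply_eq_mul_chartGen γ 0 j.succ]
  -- `(t, w')` is a regular system of parameters of `𝒪_y`
  let w₀ : Fin 0 → X.presheaf.stalk (π y) := fun l => l.elim0
  have hrange : Set.range (Fin.append γ w₀) = Set.range γ := by
    ext a
    constructor
    · rintro ⟨m, rfl⟩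
      refine Fin.addCases (fun j => ?_) (fun l => l.elim0) m
      exact ⟨j, by rw [Fin.append_left]⟩
    · rintro ⟨j, rfl⟩
      exact ⟨Fin.castAdd 0 j, by rw [Fin.append_left]⟩
  have hzw : Ideal.span (Set.range (Fin.append γ w₀)) = maximalIdeal _ := by rw [hrange, hfull]
  have hd' : (maximalIdeal (X.presheaf.stalk (π y))).spanFinrank = (r + 1) + 0 := by
    have h1 := IsRegularLocalRing.spanFinrank_maximalIdeal (R := X.presheaf.stalk (π y))
    rw [hdim] at h1
    exact_mod_cast h1
  let jJ : Fin r → {j : Fin (r + 1) // j ≠ 0} := fun l => ⟨l.succ, l.succ_ne_zero⟩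
  have hjJ : Function.Injective jJ := fun a a' haa => Fin.succ_injective _ (congrArg Subtype.val haa)
  have hR := isRsopPart_chartFamily_reesChart γ 0 w₀ hzw hd' 𝔴.asIdeal h𝔴 (X'.presheaf.stalk y) jJ hjJ
    (fun l => hmem𝔴 l)
  have hfam : chartFamily γ 0 w₀ (X'.presheaf.stalk y) (chartBase γ 0) (chartGen γ 0) jJ =
      (Fin.cons t w' : Fin (r + 1) → X'.presheaf.stalk y) := by
    funext m
    induction m using Fin.cases with
    | zero => simp only [chartFamily, Fin.cons_zero, halg, htdef]
    | succ j =>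
      simp only [chartFamily, Fin.cons_succ]
      exact (Fin.append_left _ _ j).trans (halg _)
  have hR' : IsRsopPart (Fin.cons t w' : Fin (r + 1) → X'.presheaf.stalk y) := by
    rw [hfam] at hR; exact hR
  -- dimension bookkeeping: `dim 𝒪_y = r + 1`
  haveI : IsDomain (X.presheaf.stalk (π y)) := isDomain_of_isRegularLocalRing _
  have hle : ringKrullDim (X'.presheaf.stalk y) ≤ ((r + 1 : ℕ) : WithBot ℕ∞) := by
    rw [← hdim]; exact ringKrullDim_localization_chartRing_le γ 0 𝔴.asIdeal h𝔴 (X'.presheaf.stalk y)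
  have hspan_le : Ideal.span (Set.range (Fin.cons t w' : Fin (r + 1) → X'.presheaf.stalk y)) ≤ maximalIdeal _ :=
    Ideal.span_le.mpr (by rintro _ ⟨m, rfl⟩; exact hR'.mem_maximalIdeal m)
  have hge : ((r + 1 : ℕ) : WithBot ℕ∞) ≤ ringKrullDim (X'.presheaf.stalk y) := by
    have h1 := hR'.ringKrullDim_quotient_add
    haveI : Nontrivial (X'.presheaf.stalk y ⧸ Ideal.span (Set.range (Fin.cons t w' : Fin (r + 1) → _))) :=
      Ideal.Quotient.nontrivial_iff.mpr (ne_top_of_le_ne_top (maximalIdeal.isMaximal _).ne_top hspan_le)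
    calc ((r + 1 : ℕ) : WithBot ℕ∞) = 0 + ((r + 1 : ℕ) : WithBot ℕ∞) := (zero_add _).symm
      _ ≤ ringKrullDim (X'.presheaf.stalk y ⧸ Ideal.span (Set.range (Fin.cons t w' : Fin (r + 1) → _))) +
            ((r + 1 : ℕ) : WithBot ℕ∞) := add_le_add ringKrullDim_nonneg_of_nontrivial le_rfl
      _ = ringKrullDim (X'.presheaf.stalk y) := h1
  have hdim' : ringKrullDim (X'.presheaf.stalk y) = ((r + 1 : ℕ) : WithBot ℕ∞) := le_antisymm hle hge
  have hfull' : Ideal.span (Set.range (Fin.cons t w' : Fin (r + 1) → _)) = maximalIdeal _ :=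
    span_eq_maximalIdeal_of_dim_le hR' hdim'.le
  -- the strict transform of `H` has stalk `(w')`
  set N : Ideal (X'.presheaf.stalk y) := Ideal.span (Set.range w') with hNdef
  have hNprime : N.IsPrime := (isRsopPart_tail hR').isPrime_span_range
  have htN : t ∉ N := by
    have h1 := hR'.not_mem_span_image (S := Set.range (Fin.succ : Fin r → Fin (r + 1))) (i := 0)
      (by rintro ⟨j, hj⟩; exact Fin.succ_ne_zero j hj)
    rwa [Fin.cons_zero, ← Set.range_comp, cons_comp_succ] at h1
  have hHmap : (stalkIdeal H (π y)).map σ = Ideal.span {t} * N := by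
    rw [hHw, Ideal.map_span, hNdef, Ideal.span_mul_span', Set.singleton_mul]
    congr 1
    ext a
    simp only [Set.mem_image, Set.mem_range]
    constructor
    · rintro ⟨_, ⟨j, rfl⟩, rfl⟩; exact ⟨w' j, ⟨j, rfl⟩, (hww' j).symm⟩
    · rintro ⟨_, ⟨j, rfl⟩, rfl⟩; exact ⟨w j, ⟨j, rfl⟩, hww' j⟩
  have hstrict : stalkIdeal (strictTransformIdeal π C H) y = N := by
    rw [stalkIdeal_strictTransformIdeal π C H y, hHmap, hE]
    exact iSup_colon_span_singleton_mul_eq hnzd hNprime htN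
  refine ⟨⟨w', isRsopPart_tail hR', hstrict, hdim'⟩, ?_⟩
  -- the exact depth drop
  intro c ν f hcb hν hfI hfQ hfnQ
  rw [hHw] at hfQ hfnQ
  rw [hstrict]
  have h3 : σ f ∈ Ideal.span {t ^ b} := by
    have hm : σ f ∈ (maximalIdeal _ ^ b).map σ := Ideal.mem_map_of_mem _ (hIb hfI)
    rw [Ideal.map_pow, ← hC, ← stalkIdeal_comap_eq_map_stalkMap, hE, Ideal.span_singleton_pow] at hm
    exact hm
  obtain ⟨f', hf'⟩ := Ideal.mem_span_singleton'.mp h3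
  have hI' : stalkIdeal (controlledTransform π C I b) y =
      Submodule.colon ((stalkIdeal I (π y)).map σ) {t ^ b} := by
    rw [hπ.stalkIdeal_controlledTransform I b y, stalkIdeal_comap_eq_map_stalkMap, hE, Ideal.span_singleton_pow,
      Submodule.colon_span]
  have hf'I : f' ∈ stalkIdeal (controlledTransform π C I b) y := by
    rw [hI', Submodule.mem_colon_singleton, smul_eq_mul, hf']
    exact Ideal.mem_map_of_mem _ hfI
  exact ⟨f', hf'I, depth_point_law σ hsw hfull hR' hfull' hσs hww' hnzd hcb hν (by rw [← hf', mul_comm]) hfQ hfnQ⟩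

/-- **FOREIGN ROUND.** Over a point off the centre the blowing up is a local isomorphism: the frame is transported and
exact depths are KEPT. (Sources: GortzWedhorn2020, (13.19) p. 414.) -/
theorem curveFrame_foreign (hπ : IsBlowup π C) [IsLocallyNoetherian X] [IsLocallyNoetherian X'] (y : X')
    (H : X.IdealSheafData) (r : ℕ) (hy : π y ∉ (C.support : Set X)) (h : CurveFrame H r (π y))
    (I : X.IdealSheafData) (b : ℕ) :
    CurveFrame (strictTransformIdeal π C H) r y ∧
      DepthKeep (stalkIdeal I (π y)) (stalkIdeal H (π y))
        (stalkIdeal (controlledTransform π C I b) y) (stalkIdeal (strictTransformIdeal π C H) y) := by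
  obtain ⟨w, hw, hHw, hdim⟩ := h
  have hy' : π y ∉ C.support := hy
  haveI := hπ.isIso_stalkMap_of_not_mem_support hy'
  have hbij := ConcreteCategory.bijective_of_isIso (π.stalkMap y)
  set σ := (π.stalkMap y).hom with hσ
  let e : X.presheaf.stalk (π y) ≃+* X'.presheaf.stalk y := RingEquiv.ofBijective σ hbij
  have he : ∀ a, e a = σ a := fun a => rfl
  have hmapE : ∀ J : Ideal (X.presheaf.stalk (π y)), J.map e = J.map σ := fun J => rfl
  have hI' : stalkIdeal (controlledTransform π C I b) y = (stalkIdeal I (π y)).map σ := by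
    rw [hπ.stalkIdeal_controlledTransform_of_not_mem I b hy', stalkIdeal_comap_eq_map_stalkMap]
  have hPmap : (Ideal.span (Set.range w)).map e = Ideal.span (Set.range (e ∘ w)) := by
    rw [Ideal.map_span, Set.range_comp]
  have hH' : stalkIdeal (strictTransformIdeal π C H) y = Ideal.span (Set.range (e ∘ w)) := by
    rw [hπ.stalkIdeal_strictTransformIdeal_of_not_mem H hy', stalkIdeal_comap_eq_map_stalkMap, hHw, ← hmapE, hPmap]
  refine ⟨⟨e ∘ w, hw.map_ringEquiv e, hH', ?_⟩, ?_⟩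
  · rw [← hdim]; exact (ringKrullDim_eq_of_ringEquiv e).symm
  · intro c ν f hfI hfQ hfnQ
    rw [hHw] at hfQ hfnQ
    refine ⟨σ f, by rw [hI']; exact Ideal.mem_map_of_mem _ hfI, ?_, ?_⟩
    · rw [hH', ← hPmap, ← he]; exact (mem_depthIdeal_iff_of_ringEquiv e _ c ν f).mp hfQ
    · rw [hH', ← hPmap, ← he]; exact fun h' => hfnQ ((mem_depthIdeal_iff_of_ringEquiv e _ c (ν + 1) f).mpr h')

end CurveFrameKernel

end Summit.ResolutionOfSingularities.ResolutionOfSingularities.Theorems.AbsoluteContactClasses
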